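import Literature.Topology.CoveringSpaces.CoveringGaloisCorrespondenceFinite
import Literature.AnabelianGeometry.AbsoluteAnabelian.RigidFunctors
import Mathlib.CategoryTheory.ObjectProperty.Equivalence
import HarnessLib

/-!
# Transport of the categories of covering spaces along a homeomorphism of the base:
# `Cov(X) ≌ Cov(Y)`, `Cov^fin(X) ≌ Cov^fin(Y)` for `X ≃ₜ Y`; id-rigidity is homeomorphism-invariant

Topic `Literature/Topology/CoveringSpaces` — a utility for the id-rigidity capstone of the
topological Galois correspondence (abc-iut cell, campaign-L R1, GAP row G-L4t14-R1): the theorems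
`Cov.isIdRigid_compl_finite` / `CovFin.isIdRigid_compl_finite` are stated for the plane model
`ℂ ∖ F`; every other model of the same curve (`ℙ¹ ∖ S` with `∞ ∈ S`, a punctured complex torus
`E(ℂ) ∖ {O}` versus the real torus `(ℝ/ℤ)² ∖ {x₀}`, …) is reached by a HOMEOMORPHISM of the base,
along which the categories of (finite) covering spaces are equivalent:

* `isCovering_of_iso`, `isFiniteCovering_of_iso` — the properties «covering map», «finite
  covering map» on `Over (TopCat.of X)` are closed under isomorphisms over `X`;
* **`Cov.equivOfHomeomorph e : Cov X ≌ Cov Y`**, **`CovFin.equivOfHomeomorph e : CovFin X ≌ CovFin Y`**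
  for `e : X ≃ₜ Y` (post-composition with `e`; Mathlib's `Over.mapIso` restricted to the full
  subcategories by `Equivalence.congrFullSubcategory`);
* **`Cov.isIdRigid_iff_of_homeomorph`**, **`CovFin.isIdRigid_iff_of_homeomorph`** — id-rigidity of
  the categories of (finite) covering spaces is a homeomorphism invariant of the base.

Everything is proved; definitions `Cov.equivOfHomeomorph`, `CovFin.equivOfHomeomorph`; no
instances (closure under isomorphisms is supplied locally by `haveI`), no named facts.

## References

* A. Hatcher, *Algebraic Topology*, CUP 2002, §1.3 p. 67 (isomorphism of covering spaces).
  [HatcherAT2002]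
* S. Mochizuki, *Topics in Absolute Anabelian Geometry III*, §0 p. 27 (id-rigid categories).
  [MochizukiAbsTopIII2015]
-/

noncomputable section

open CategoryTheory Set Topology
open Literature.AnabelianGeometry.AbsoluteAnabelian (IsIdRigid isIdRigid_of_equivalence
  isIdRigid_of_equivalence')

universe u

namespace Literature.Topology.CoveringSpaces

variable {X Y : Type u} [TopologicalSpace X] [TopologicalSpace Y]

/-! ### Closure under isomorphisms over the base -/

/-- An isomorphism of spaces over `X` intertwines the structure maps through the homeomorphism of
total spaces it induces: `p' = p ∘ φ`. [cite: HatcherAT2002, §1.3 p.67] -/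
theorem over_hom_eq_comp_homeoOfIso {E E' : Over (TopCat.of X)} (i : E ≅ E') :
    (E'.hom : E'.left → X) =
      (E.hom : E.left → X) ∘ TopCat.homeoOfIso ((Over.forget (TopCat.of X)).mapIso i.symm) := by
  funext a
  exact (ConcreteCategory.congr_hom (Over.w i.inv) a).symm

/-- «The structure map is a covering map» is closed under isomorphisms over `X`.
[cite: HatcherAT2002, §1.3 p.67] -/
theorem isCovering_of_iso {E E' : Over (TopCat.of X)} (i : E ≅ E') (h : IsCovering X E) :
    IsCovering X E' := by
  change IsCoveringMap (E'.hom : E'.left → X)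
  rw [over_hom_eq_comp_homeoOfIso i]
  exact IsCoveringMap.comp_homeomorph h _

/-- «The structure map is a covering map» is invariant under isomorphisms over `X`.
[cite: HatcherAT2002, §1.3 p.67] -/
theorem isCovering_iff_of_iso {E E' : Over (TopCat.of X)} (i : E ≅ E') :
    IsCovering X E ↔ IsCovering X E' :=
  ⟨isCovering_of_iso i, isCovering_of_iso i.symm⟩

/-- «The structure map is a finite covering map» is closed under isomorphisms over `X` (the
fibres correspond under the induced homeomorphism of total spaces). [cite: HatcherAT2002, §1.3 p.67] -/
theorem isFiniteCovering_of_iso {E E' : Over (TopCat.of X)} (i : E ≅ E') (h : IsFiniteCovering X E) :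
    IsFiniteCovering X E' := by
  refine ⟨isCovering_of_iso i h.1, fun x ↦ ?_⟩
  haveI := h.2 x
  let ψ : E.left ≃ₜ E'.left := TopCat.homeoOfIso ((Over.forget (TopCat.of X)).mapIso i)
  refine Finite.of_injective (fun a : ↥((E'.hom : E'.left → X) ⁻¹' {x}) ↦
    (⟨ψ.symm a.1, ?_⟩ : ↥((E.hom : E.left → X) ⁻¹' {x}))) ?_
  · have h1 : (E.hom : E.left → X) (ψ.symm a.1) = (E'.hom : E'.left → X) a.1 :=
      ConcreteCategory.congr_hom (Over.w i.inv) a.1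
    rw [mem_preimage, h1]
    exact a.2
  · intro a b hab
    exact Subtype.ext (ψ.symm.injective (congrArg Subtype.val hab))

/-- «Finite covering map» is invariant under isomorphisms over `X`. [cite: HatcherAT2002, §1.3 p.67] -/
theorem isFiniteCovering_iff_of_iso {E E' : Over (TopCat.of X)} (i : E ≅ E') :
    IsFiniteCovering X E ↔ IsFiniteCovering X E' :=
  ⟨isFiniteCovering_of_iso i, isFiniteCovering_of_iso i.symm⟩

variable (X) in
/-- `IsCovering X` respects isomorphisms (as a Mathlib `ObjectProperty`).
[cite: HatcherAT2002, §1.3 p.67] -/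
theorem isClosedUnderIsomorphisms_isCovering : (IsCovering X).IsClosedUnderIsomorphisms :=
  ⟨fun i h ↦ isCovering_of_iso i h⟩

variable (X) in
/-- `IsFiniteCovering X` respects isomorphisms (as a Mathlib `ObjectProperty`).
[cite: HatcherAT2002, §1.3 p.67] -/
theorem isClosedUnderIsomorphisms_isFiniteCovering :
    (IsFiniteCovering X).IsClosedUnderIsomorphisms :=
  ⟨fun i h ↦ isFiniteCovering_of_iso i h⟩

/-! ### Post-composition with a homeomorphism of the base -/

/-- `e ∘ p` is a covering map iff `p` is, for a homeomorphism `e : X ≃ₜ Y` of the base: the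
inverse image of `IsCovering Y` under `Over.map e` is `IsCovering X`. [cite: HatcherAT2002, §1.3 p.67] -/
theorem inverseImage_isCovering_map (e : X ≃ₜ Y) :
    (IsCovering Y).inverseImage (Over.map (TopCat.isoOfHomeo e).hom) = IsCovering X := by
  funext U
  exact propext (IsCoveringMap.homeomorph_comp_iff (f := (U.hom : U.left → X)) e)

/-- The fibre of `e ∘ p` over `y` is the fibre of `p` over `e⁻¹ y`. [cite: HatcherAT2002, §1.3 p.67] -/
theorem preimage_homeomorph_comp_singleton {E : Type u} (p : E → X) (e : X ≃ₜ Y) (y : Y) :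
    (e ∘ p) ⁻¹' {y} = p ⁻¹' {e.symm y} := by
  ext a
  simp only [Set.mem_preimage, Function.comp_apply, Set.mem_singleton_iff]
  constructor
  · intro h
    rw [← h, Homeomorph.symm_apply_apply]
  · intro h
    rw [h, Homeomorph.apply_symm_apply]

/-- `e ∘ p` is a finite covering map iff `p` is, for a homeomorphism `e` of the base.
[cite: HatcherAT2002, §1.3 p.67] -/
theorem inverseImage_isFiniteCovering_map (e : X ≃ₜ Y) :
    (IsFiniteCovering Y).inverseImage (Over.map (TopCat.isoOfHomeo e).hom) = IsFiniteCovering X := by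
  funext U
  refine propext ⟨fun h ↦ ⟨(IsCoveringMap.homeomorph_comp_iff (f := (U.hom : U.left → X)) e).1 h.1,
    fun x ↦ ?_⟩, fun h ↦ ⟨(IsCoveringMap.homeomorph_comp_iff (f := (U.hom : U.left → X)) e).2 h.1,
    fun y ↦ ?_⟩⟩
  · have := h.2 (e x)
    change Finite ↥((e ∘ (U.hom : U.left → X)) ⁻¹' {e x}) at this
    rwa [preimage_homeomorph_comp_singleton, e.symm_apply_apply] at this
  · change Finite ↥((e ∘ (U.hom : U.left → X)) ⁻¹' {y})
    rw [preimage_homeomorph_comp_singleton]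
    exact h.2 _

namespace Cov

/-- **`Cov(X) ≌ Cov(Y)` for a homeomorphism `e : X ≃ₜ Y`**: a covering space `p : E → X` goes to
`e ∘ p : E → Y`. [cite: HatcherAT2002, §1.3 p.67] -/
def equivOfHomeomorph (e : X ≃ₜ Y) : Cov X ≌ Cov Y :=
  haveI := isClosedUnderIsomorphisms_isCovering Y
  (Over.mapIso (TopCat.isoOfHomeo e)).congrFullSubcategory (by
    rw [Over.mapIso_functor]
    exact inverseImage_isCovering_map e)

/-- The transported covering space has the same total space. [cite: HatcherAT2002, §1.3 p.67] -/
@[simp] theorem equivOfHomeomorph_functor_obj_left (e : X ≃ₜ Y) (E : Cov X) :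
    ((equivOfHomeomorph e).functor.obj E).obj.left = E.obj.left := rfl

/-- The transported covering space has projection `e ∘ p`. [cite: HatcherAT2002, §1.3 p.67] -/
theorem equivOfHomeomorph_functor_obj_proj (e : X ≃ₜ Y) (E : Cov X) :
    ((equivOfHomeomorph e).functor.obj E).proj = e ∘ E.proj := rfl

/-- **Id-rigidity of `Cov` is a homeomorphism invariant of the base.**
[cite: MochizukiAbsTopIII2015, Section 0 p.27] -/
theorem isIdRigid_iff_of_homeomorph (e : X ≃ₜ Y) : IsIdRigid (Cov X) ↔ IsIdRigid (Cov Y) :=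
  ⟨isIdRigid_of_equivalence' (equivOfHomeomorph e), isIdRigid_of_equivalence (equivOfHomeomorph e)⟩

end Cov

namespace CovFin

/-- **`Cov^fin(X) ≌ Cov^fin(Y)` for a homeomorphism `e : X ≃ₜ Y`.** [cite: HatcherAT2002, §1.3 p.67] -/
def equivOfHomeomorph (e : X ≃ₜ Y) : CovFin X ≌ CovFin Y :=
  haveI := isClosedUnderIsomorphisms_isFiniteCovering Y
  (Over.mapIso (TopCat.isoOfHomeo e)).congrFullSubcategory (by
    rw [Over.mapIso_functor]
    exact inverseImage_isFiniteCovering_map e)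

/-- The transported finite covering space has the same total space. [cite: HatcherAT2002, §1.3 p.67] -/
@[simp] theorem equivOfHomeomorph_functor_obj_left (e : X ≃ₜ Y) (E : CovFin X) :
    ((equivOfHomeomorph e).functor.obj E).obj.left = E.obj.left := rfl

/-- **Id-rigidity of `Cov^fin` is a homeomorphism invariant of the base.**
[cite: MochizukiAbsTopIII2015, Section 0 p.27] -/
theorem isIdRigid_iff_of_homeomorph (e : X ≃ₜ Y) : IsIdRigid (CovFin X) ↔ IsIdRigid (CovFin Y) :=
  ⟨isIdRigid_of_equivalence' (equivOfHomeomorph e), isIdRigid_of_equivalence (equivOfHomeomorph e)⟩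

end CovFin

end Literature.Topology.CoveringSpaces

end
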